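import Mathlib
import Summits.NavierStokesRegularity.NavierStokesRegularity.Theorems.EulerZoomLiouvillePowerGaugeEulerLiouvilleTwoSidedMomentScale
import Summits.NavierStokesRegularity.NavierStokesRegularity.Theorems.EulerZoomLiouvillePowerGaugeEulerLiouvilleTwoSidedMomentBounds
import HarnessLib

/-!
# t57-F1, step 3: THE TWO-SIDED MOMENT LAW `|m_g(R) − L| ≤ C·R^{−(1−q₀)(1+ρ/2)}`, uniformly in `q ≤ q₀ < 1`
# (nsreg-p2 ROUND-53 «THE FLOOR» v1.0 b996910b42100ad1, `r53/Sketch53.lean` 8300150c723efd46 §A (F1) `NsregP2.R53.Floor.TwoSidedMomentLaw ρ V`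
# VERBATIM unfolded; key 07:12:23Z, sfl-p1 lineage first refusal; seat ns-sfl-p1 g9, `--supports stmt-NavierStokesRegularity-19832 --as helper`)

Assembly: `hasDerivAt_normalisedMoment` (`…TwoSidedMomentScale`) gives `m_g′(R) = R^{−a−1}(q·Str_g + R⁻¹Sph_g)/γ`, `a = 3 − q(2+ρ)`;
`stretch_bound_weight` / `sphere_bound_weight` / `trivialConst_le` (`…TwoSidedMomentBounds`) give the TWO-SIDED bound `|m_g′(R)| ≤ K·R^{−1−δ₀}`
for `R ≥ 1` with ONE `K` for all `q ∈ (0, q₀]`, `δ₀ = (1−q₀)(1+ρ/2)` (`deriv_normalisedMoment_bound`); the MONOTONE SANDWICH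
`H± = m_g ± (K/δ₀)R^{−δ₀}` (`H₋ ↑`, `H₊ ↓` on `[1,∞)`) yields a common limit `L` with `|m_g(R) − L| ≤ (K/δ₀)R^{−δ₀}`
(`exists_limit_of_deriv_bound`, no measurability of `R ↦ m_g′(R)` needed) — ★ `twoSidedMomentLaw`.

HONEST FRAMING: a two-sided PORTRAIT law for HYPOTHETICAL budget-class profiles (R53 instrument); it kills nothing; nothing about the
crux E (19832 OPEN) or NS regularity is proved here. [nsreg-p2 R53 §2 (F1); cite: ChaeShvydkoy2013 §4 eq. (4.2); BronziShvydkoy (energy analogue)] [folklore]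
-/

noncomputable section

set_option linter.dupNamespace false

open Set Filter Topology Metric Function MeasureTheory InnerProductSpace
open scoped Topology ENNReal RealInnerProductSpace

namespace Summit.NavierStokesRegularity.NavierStokesRegularity.Theorems.PowerGaugeEulerLiouville

open Literature.Analysis Literature.Analysis.FluidPDE

namespace TwoSidedMoment

/-! ## The monotone sandwich -/

/-- **Limit with rate from a two-sided power bound on the derivative** (monotone sandwich, no integrability of the derivative needed):
if `G` is differentiable on `(0,∞)` with `|G′(R)| ≤ K·R^{−1−δ}` for `R ≥ 1` (`δ > 0`, `K ≥ 0`), then there is `L` with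
`|G(R) − L| ≤ (K/δ)·R^{−δ}` for all `R ≥ 1` (`H± = G ± (K/δ)R^{−δ}` are antitone/monotone on `[1,∞)`; `L = sup H₋`). [folklore] -/
theorem exists_limit_of_deriv_bound {G G' : ℝ → ℝ} {K δ : ℝ} (hδ : 0 < δ) (hK : 0 ≤ K)
    (hG : ∀ R : ℝ, 0 < R → HasDerivAt G (G' R) R) (hbd : ∀ R : ℝ, 1 ≤ R → |G' R| ≤ K * R ^ (-1 - δ)) :
    ∃ L : ℝ, ∀ R : ℝ, 1 ≤ R → |G R - L| ≤ K / δ * R ^ (-δ) := by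
  set Hp : ℝ → ℝ := fun R => G R + K / δ * R ^ (-δ) with hHpdef
  set Hm : ℝ → ℝ := fun R => G R - K / δ * R ^ (-δ) with hHmdef
  have hpow : ∀ R : ℝ, 0 < R → HasDerivAt (fun R : ℝ => K / δ * R ^ (-δ)) (-(K * R ^ (-1 - δ))) R := by
    intro R hR
    have h := (Real.hasDerivAt_rpow_const (p := -δ) (Or.inl hR.ne')).const_mul (K / δ)
    refine h.congr_deriv ?_
    rw [show -δ - 1 = -1 - δ by ring]
    field_simp
  have hHp : ∀ R : ℝ, 0 < R → HasDerivAt Hp (G' R + -(K * R ^ (-1 - δ))) R := fun R hR => (hG R hR).add (hpow R hR)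
  have hHm : ∀ R : ℝ, 0 < R → HasDerivAt Hm (G' R - -(K * R ^ (-1 - δ))) R := fun R hR => (hG R hR).sub (hpow R hR)
  have hanti : AntitoneOn Hp (Ici 1) := by
    refine antitoneOn_of_hasDerivWithinAt_nonpos (convex_Ici 1) (f' := fun R => G' R + -(K * R ^ (-1 - δ)))
      (fun R hR => (hHp R (by linarith [mem_Ici.1 hR])).continuousAt.continuousWithinAt) ?_ ?_
    · intro R hR
      rw [interior_Ici] at hR
      exact (hHp R (by linarith [mem_Ioi.1 hR])).hasDerivWithinAt
    · intro R hR
      rw [interior_Ici] at hR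
      have := (abs_le.1 (hbd R (le_of_lt hR))).2
      linarith
  have hmono : MonotoneOn Hm (Ici 1) := by
    refine monotoneOn_of_hasDerivWithinAt_nonneg (convex_Ici 1) (f' := fun R => G' R - -(K * R ^ (-1 - δ)))
      (fun R hR => (hHm R (by linarith [mem_Ici.1 hR])).continuousAt.continuousWithinAt) ?_ ?_
    · intro R hR
      rw [interior_Ici] at hR
      exact (hHm R (by linarith [mem_Ioi.1 hR])).hasDerivWithinAt
    · intro R hR
      rw [interior_Ici] at hR
      have := (abs_le.1 (hbd R (le_of_lt hR))).1
      linarith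
  have hle : ∀ R : ℝ, 1 ≤ R → Hm R ≤ Hp R := by
    intro R hR
    have : 0 ≤ K / δ * R ^ (-δ) := mul_nonneg (div_nonneg hK hδ.le) (Real.rpow_nonneg (by linarith) _)
    simp only [hHpdef, hHmdef]
    linarith
  have hbdd : BddAbove (Hm '' Ici 1) := by
    refine ⟨Hp 1, ?_⟩
    rintro _ ⟨R, hR, rfl⟩
    exact (hle R hR).trans (hanti (self_mem_Ici) hR hR)
  have hne : (Hm '' Ici 1).Nonempty := ⟨Hm 1, 1, self_mem_Ici, rfl⟩
  refine ⟨sSup (Hm '' Ici 1), fun R hR => ?_⟩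
  have h1 : Hm R ≤ sSup (Hm '' Ici 1) := le_csSup hbdd ⟨R, hR, rfl⟩
  have h2 : sSup (Hm '' Ici 1) ≤ Hp R := by
    refine csSup_le hne ?_
    rintro _ ⟨R', hR', rfl⟩
    have hmax : max R R' ∈ Ici (1 : ℝ) := le_trans hR (le_max_left _ _)
    calc Hm R' ≤ Hm (max R R') := hmono hR' hmax (le_max_right _ _)
      _ ≤ Hp (max R R') := hle _ hmax
      _ ≤ Hp R := hanti hR hmax (le_max_left _ _)
  simp only [hHpdef, hHmdef] at h1 h2
  rw [abs_sub_le_iff]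
  constructor <;> linarith

/-! ## The two-sided derivative bound, uniform in `q ≤ q₀` -/

section Profile

variable {V : EuclideanSpace ℝ (Fin 3) → EuclideanSpace ℝ (Fin 3)} {g : EuclideanSpace ℝ (Fin 3) → ℝ}

/-- `√(c·(r₁R)^x) = √c · r₁^{x/2} · R^{x/2}` for `c ≥ 0`, `r₁, R ≥ 0`. [folklore] -/
theorem sqrt_const_mul_prod_rpow {c r₁ R : ℝ} (hc : 0 ≤ c) (hr : 0 ≤ r₁) (hR : 0 ≤ R) (x : ℝ) :
    Real.sqrt (c * (r₁ * R) ^ x) = Real.sqrt c * r₁ ^ (x / 2) * R ^ (x / 2) := by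
  rw [Real.mul_rpow hr hR, Real.sqrt_mul hc, Real.sqrt_mul (Real.rpow_nonneg hr _), SmallMoment.sqrt_rpow_eq hr,
    SmallMoment.sqrt_rpow_eq hR]
  ring

/-- **Pure-real bookkeeping of the two budget bounds** (`R ≥ 1`, `r₁ ≥ 1`, `0 < q ≤ q₀ < 1`, `a = 3 − q(2+ρ)`, `δ₀ = (1−q₀)(1+ρ/2)`):
from `|S| ≤ B₀·√K₁ r₁^{a/2}R^{a/2}·√E_w r₁^{(1−ρ)/2}R^{(1−ρ)/2}` and `|U| ≤ B₁·√K₁ r₁^{a/2}R^{a/2}·√A r₁^{(1−2ρ)/2}R^{(1−2ρ)/2}`, `K₁ ≤ K*`,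
conclude `|R^{−a−1}(qS + R⁻¹U)/γ| ≤ (B₀√K*√E_w + B₁√K*√A)·r₁²/γ·R^{−1−δ₀}`. [folklore] -/
theorem abs_scaleDeriv_le_of_bounds {ρ q q₀ a δ₀ R r₁ B₀ B₁ K₁ Kstar Ew A S U γ : ℝ}
    (hρ : 0 < ρ) (hρ1 : ρ < 1) (hq : 0 < q) (hqq₀ : q ≤ q₀) (hq₀1 : q₀ < 1) (hR : 1 ≤ R) (hr₁1 : 1 ≤ r₁) (hγ : 0 < γ)
    (hadef : a = 3 - q * (2 + ρ)) (hδ₀def : δ₀ = (1 - q₀) * (1 + ρ / 2))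
    (hB₀ : 0 ≤ B₀) (hB₁ : 0 ≤ B₁) (hK₁le : K₁ ≤ Kstar)
    (hS : |S| ≤ B₀ * (Real.sqrt K₁ * r₁ ^ (a / 2) * R ^ (a / 2) * (Real.sqrt Ew * r₁ ^ ((1 - ρ) / 2) * R ^ ((1 - ρ) / 2))))
    (hU : |U| ≤ B₁ * (Real.sqrt K₁ * r₁ ^ (a / 2) * R ^ (a / 2) * (Real.sqrt A * r₁ ^ ((1 - 2 * ρ) / 2) * R ^ ((1 - 2 * ρ) / 2)))) :
    |R ^ (-a - 1) * ((q * S + R⁻¹ * U) / γ)| ≤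
      (B₀ * Real.sqrt Kstar * Real.sqrt Ew + B₁ * Real.sqrt Kstar * Real.sqrt A) * r₁ ^ (2 : ℝ) / γ * R ^ (-1 - δ₀) := by
  have hq1 : q ≤ 1 := by linarith
  have hR0 : 0 < R := by linarith
  have hr₁0 : 0 < r₁ := by linarith
  have hsK : Real.sqrt K₁ ≤ Real.sqrt Kstar := Real.sqrt_le_sqrt hK₁le
  have hr_S : r₁ ^ (a / 2) * r₁ ^ ((1 - ρ) / 2) ≤ r₁ ^ (2 : ℝ) := by
    rw [← Real.rpow_add hr₁0]
    exact Real.rpow_le_rpow_of_exponent_le hr₁1 (by rw [hadef]; nlinarith)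
  have hr_U : r₁ ^ (a / 2) * r₁ ^ ((1 - 2 * ρ) / 2) ≤ r₁ ^ (2 : ℝ) := by
    rw [← Real.rpow_add hr₁0]
    exact Real.rpow_le_rpow_of_exponent_le hr₁1 (by rw [hadef]; nlinarith)
  have hR_S : R ^ (-a - 1) * (R ^ (a / 2) * R ^ ((1 - ρ) / 2)) ≤ R ^ (-1 - δ₀) := by
    rw [← Real.rpow_add hR0, ← Real.rpow_add hR0]
    exact Real.rpow_le_rpow_of_exponent_le hR (by rw [hadef, hδ₀def]; nlinarith)
  have hR_U : R ^ (-a - 1) * (R⁻¹ * (R ^ (a / 2) * R ^ ((1 - 2 * ρ) / 2))) ≤ R ^ (-1 - δ₀) := by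
    rw [← Real.rpow_neg_one, ← Real.rpow_add hR0, ← Real.rpow_add hR0, ← Real.rpow_add hR0]
    exact Real.rpow_le_rpow_of_exponent_le hR (by rw [hadef, hδ₀def]; nlinarith)
  have hRa : 0 < R ^ (-a - 1) := Real.rpow_pos_of_pos hR0 _
  have hS' : |S| ≤ B₀ * Real.sqrt Kstar * Real.sqrt Ew * r₁ ^ (2 : ℝ) * (R ^ (a / 2) * R ^ ((1 - ρ) / 2)) := by
    calc |S| ≤ B₀ * (Real.sqrt K₁ * r₁ ^ (a / 2) * R ^ (a / 2) * (Real.sqrt Ew * r₁ ^ ((1 - ρ) / 2) * R ^ ((1 - ρ) / 2))) := hS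
      _ = B₀ * Real.sqrt K₁ * Real.sqrt Ew * (r₁ ^ (a / 2) * r₁ ^ ((1 - ρ) / 2)) * (R ^ (a / 2) * R ^ ((1 - ρ) / 2)) := by ring
      _ ≤ B₀ * Real.sqrt Kstar * Real.sqrt Ew * r₁ ^ (2 : ℝ) * (R ^ (a / 2) * R ^ ((1 - ρ) / 2)) := by gcongr
  have hU' : |U| ≤ B₁ * Real.sqrt Kstar * Real.sqrt A * r₁ ^ (2 : ℝ) * (R ^ (a / 2) * R ^ ((1 - 2 * ρ) / 2)) := by
    calc |U| ≤ B₁ * (Real.sqrt K₁ * r₁ ^ (a / 2) * R ^ (a / 2) * (Real.sqrt A * r₁ ^ ((1 - 2 * ρ) / 2) * R ^ ((1 - 2 * ρ) / 2))) := hU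
      _ = B₁ * Real.sqrt K₁ * Real.sqrt A * (r₁ ^ (a / 2) * r₁ ^ ((1 - 2 * ρ) / 2)) * (R ^ (a / 2) * R ^ ((1 - 2 * ρ) / 2)) := by ring
      _ ≤ B₁ * Real.sqrt Kstar * Real.sqrt A * r₁ ^ (2 : ℝ) * (R ^ (a / 2) * R ^ ((1 - 2 * ρ) / 2)) := by gcongr
  have hcomb : |R ^ (-a - 1) * ((q * S + R⁻¹ * U) / γ)| ≤ R ^ (-a - 1) * ((|S| + R⁻¹ * |U|) / γ) := by
    rw [abs_mul, abs_of_pos hRa, abs_div, abs_of_pos hγ]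
    gcongr
    calc |q * S + R⁻¹ * U| ≤ |q * S| + |R⁻¹ * U| := abs_add_le _ _
      _ = q * |S| + R⁻¹ * |U| := by rw [abs_mul, abs_mul, abs_of_pos hq, abs_of_pos (inv_pos.2 hR0)]
      _ ≤ 1 * |S| + R⁻¹ * |U| := by gcongr
      _ = |S| + R⁻¹ * |U| := by rw [one_mul]
  set cS := B₀ * Real.sqrt Kstar * Real.sqrt Ew * r₁ ^ (2 : ℝ) with hcS
  set cU := B₁ * Real.sqrt Kstar * Real.sqrt A * r₁ ^ (2 : ℝ) with hcU
  have hcS0 : 0 ≤ cS := by positivity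
  have hcU0 : 0 ≤ cU := by positivity
  calc |R ^ (-a - 1) * ((q * S + R⁻¹ * U) / γ)|
      ≤ R ^ (-a - 1) * ((|S| + R⁻¹ * |U|) / γ) := hcomb
    _ ≤ R ^ (-a - 1) * ((cS * (R ^ (a / 2) * R ^ ((1 - ρ) / 2)) + R⁻¹ * (cU * (R ^ (a / 2) * R ^ ((1 - 2 * ρ) / 2)))) / γ) := by
        gcongr
    _ = (cS * (R ^ (-a - 1) * (R ^ (a / 2) * R ^ ((1 - ρ) / 2))) +
          cU * (R ^ (-a - 1) * (R⁻¹ * (R ^ (a / 2) * R ^ ((1 - 2 * ρ) / 2))))) / γ := by ring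
    _ ≤ (cS * R ^ (-1 - δ₀) + cU * R ^ (-1 - δ₀)) / γ := by gcongr
    _ = (B₀ * Real.sqrt Kstar * Real.sqrt Ew + B₁ * Real.sqrt Kstar * Real.sqrt A) * r₁ ^ (2 : ℝ) / γ * R ^ (-1 - δ₀) := by
        rw [hcS, hcU]; ring

/-- **The two-sided, `q`-uniform derivative bound**: with `E_w`, the A-gauge, weight bounds `|g| ≤ B₀`, `‖Dg‖ ≤ B₁`, `g`, `Dg` vanishing off
`B̄(0,r)`, for every `0 < q ≤ q₀ < 1` and `R ≥ 1`:
`R^{−a−1}·|q·Str_g(R) + R⁻¹·Sph_g(R)|/γ ≤ K·R^{−1−δ₀}`, `a = 3 − q(2+ρ)`, `δ₀ = (1−q₀)(1+ρ/2)`,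
`K = (B₀√(K*)√E_w + B₁√(K*)√A)·(r+1)²/γ`, `K* = (4π/3)·max 1 (16E_w)`, `γ = 1/(2+ρ)`. [nsreg-p2 R53 §2 (F1); folklore] -/
theorem deriv_normalisedMoment_bound {ρ : ℝ} (hρ : 0 < ρ) (hρ1 : ρ < 1) (hV : ContDiff ℝ 2 V)
    (hE : (∫⁻ y, ‖fderiv ℝ V y‖ₑ ^ 2 * ENNReal.ofReal (‖y‖ ^ (ρ - 1))) ≠ ⊤)
    {A : ℝ} (hA : ∀ R : ℝ, 1 ≤ R → ∫ y in ball (0 : EuclideanSpace ℝ (Fin 3)) R, ‖V y‖ ^ 2 ≤ A * R ^ (1 - 2 * ρ))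
    {B₀ B₁ r : ℝ} (hB₀ : ∀ x, |g x| ≤ B₀) (hB₁ : ∀ x, ‖fderiv ℝ g x‖ ≤ B₁) (hr : 0 < r)
    (hg0 : ∀ x, r ≤ ‖x‖ → g x = 0) (hDg0 : ∀ x, r ≤ ‖x‖ → fderiv ℝ g x = 0)
    {q₀ : ℝ} (hq₀1 : q₀ < 1) {q : ℝ} (hq : 0 < q) (hqq₀ : q ≤ q₀) {R : ℝ} (hR : 1 ≤ R) :
    |R ^ (-(3 - q * (2 + ρ)) - 1) *
        ((q * (∫ y, g (R⁻¹ • y) * (‖curl V y‖ ^ (q - 2) * ⟪fderiv ℝ V y (curl V y), curl V y⟫)) +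
            R⁻¹ * ∫ y, ‖curl V y‖ ^ q * fderiv ℝ g (R⁻¹ • y) (V y)) / (1 / (2 + ρ)))| ≤
      (B₀ * Real.sqrt (Real.pi * 4 / 3 * max 1 (16 * (∫⁻ y, ‖fderiv ℝ V y‖ₑ ^ 2 * ENNReal.ofReal (‖y‖ ^ (ρ - 1))).toReal)) *
            Real.sqrt (∫⁻ y, ‖fderiv ℝ V y‖ₑ ^ 2 * ENNReal.ofReal (‖y‖ ^ (ρ - 1))).toReal +
          B₁ * Real.sqrt (Real.pi * 4 / 3 * max 1 (16 * (∫⁻ y, ‖fderiv ℝ V y‖ₑ ^ 2 * ENNReal.ofReal (‖y‖ ^ (ρ - 1))).toReal)) *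
            Real.sqrt A) * (r + 1) ^ (2 : ℝ) / (1 / (2 + ρ)) * R ^ (-1 - (1 - q₀) * (1 + ρ / 2)) := by
  have hq1 : q ≤ 1 := by linarith
  have hR0 : 0 < R := by linarith
  have h2ρ : 0 < 2 + ρ := by linarith
  set Ew : ℝ := (∫⁻ y, ‖fderiv ℝ V y‖ₑ ^ 2 * ENNReal.ofReal (‖y‖ ^ (ρ - 1))).toReal with hEw
  have hEw0 : 0 ≤ Ew := ENNReal.toReal_nonneg
  have hA0 : 0 ≤ A := by
    have h := hA 1 le_rfl
    rw [Real.one_rpow, mul_one] at h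
    exact (integral_nonneg fun y => sq_nonneg _).trans h
  have hB₀0 : 0 ≤ B₀ := (abs_nonneg (g 0)).trans (hB₀ 0)
  have hB₁0 : 0 ≤ B₁ := (norm_nonneg _).trans (hB₁ 0)
  set K₁ : ℝ := (Real.pi * 4 / 3) ^ (1 - 2 * q / 2) * (16 * Ew) ^ (2 * q / 2) with hK₁
  have hK₁0 : 0 ≤ K₁ := by positivity
  have hK₁le : K₁ ≤ Real.pi * 4 / 3 * max 1 (16 * Ew) := trivialConst_le hq.le hq1 hEw0
  have hr₁1 : 1 ≤ r + 1 := by linarith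
  have hr₁0 : 0 ≤ r + 1 := by linarith
  have hx : 3 * (1 - 2 * q / 2) + (1 - ρ) * (2 * q / 2) = 3 - q * (2 + ρ) := by ring
  have hS := stretch_bound_weight (V := V) (g := g) hρ1 hq hq1 hV hE hB₀ hr hg0 hR
  have hU := sphere_bound_weight (V := V) (g := g) hρ1 hq hq1 hV hE hA hB₁ hr hDg0 hR
  rw [← hEw, ← hK₁, hx, sqrt_const_mul_prod_rpow hK₁0 hr₁0 hR0.le, mul_comm (((r + 1) * R) ^ (1 - ρ)) Ew,
    sqrt_const_mul_prod_rpow hEw0 hr₁0 hR0.le] at hS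
  rw [← hEw, ← hK₁, hx, sqrt_const_mul_prod_rpow hK₁0 hr₁0 hR0.le, sqrt_const_mul_prod_rpow hA0 hr₁0 hR0.le] at hU
  exact abs_scaleDeriv_le_of_bounds hρ hρ1 hq hqq₀ hq₀1 hR hr₁1 (by positivity) rfl rfl hB₀0 hB₁0 hK₁le hS hU

/-- ★★ **THE TWO-SIDED MOMENT LAW** (`NsregP2.R53.Floor.TwoSidedMomentLaw ρ V` VERBATIM, unfolded; t57-F1): for a `C²` self-similar Euler profile
`(γ, 0, V, P)`, `γ = 1/(2+ρ)`, `0 < ρ < 1`, with finite weighted energy and the A-gauge, for EVERY `C¹` compactly supported weight `g` and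
every `q₀ < 1` there is ONE constant `C` such that for all `q ∈ (0, q₀]` the normalised moment `m_g(R) = R^{q(2+ρ)−3}∫ g(R⁻¹y)‖curl V y‖^q dy`
has a limit `L = L(q, g)` with `|m_g(R) − L| ≤ C·R^{−(1−q₀)(1+ρ/2)}` for `R ≥ 1`.  Proof: `hasDerivAt_normalisedMoment` + `deriv_normalisedMoment_bound`
+ `exists_limit_of_deriv_bound` (monotone sandwich), `C = K/δ₀`.  HONEST LABEL: a two-sided portrait law (R53 instrument); kills nothing.
[nsreg-p2 R53 §2 (F1); cite: ChaeShvydkoy2013 §4 eq. (4.2)] -/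
theorem twoSidedMomentLaw {ρ : ℝ} (hρ : 0 < ρ) (hρ1 : ρ < 1) (V : EuclideanSpace ℝ (Fin 3) → EuclideanSpace ℝ (Fin 3)) :
    ∀ P : EuclideanSpace ℝ (Fin 3) → ℝ, IsSelfSimilarEulerProfile (1 / (2 + ρ)) 0 V P →
      (∫⁻ y, ‖fderiv ℝ V y‖ₑ ^ 2 * ENNReal.ofReal (‖y‖ ^ (ρ - 1))) ≠ ⊤ →
      (∃ A : ℝ, ∀ R : ℝ, 1 ≤ R → ∫ y in Metric.ball (0 : EuclideanSpace ℝ (Fin 3)) R, ‖V y‖ ^ 2 ≤ A * R ^ (1 - 2 * ρ)) →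
        ∀ g : EuclideanSpace ℝ (Fin 3) → ℝ, ContDiff ℝ 1 g → HasCompactSupport g → ∀ q₀ : ℝ, 0 < q₀ → q₀ < 1 →
          ∃ C : ℝ, ∀ q : ℝ, 0 < q → q ≤ q₀ →
            ∃ L : ℝ, ∀ R : ℝ, 1 ≤ R →
              |R ^ (q * (2 + ρ) - 3) * (∫ y, g (R⁻¹ • y) * ‖curl V y‖ ^ q) - L| ≤ C * R ^ (-((1 - q₀) * (1 + ρ / 2))) := by
  intro P hprof hE hAex g hg hgc q₀ hq₀ hq₀1
  obtain ⟨A, hA⟩ := hAex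
  obtain ⟨B₀, B₁, r, hB₀0, hB₁0, hr, hgB, hDgB, hg0, hDg0⟩ := exists_bounds_of_weight hg hgc
  have h2ρ : 0 < 2 + ρ := by linarith
  have hγ0 : 0 < 1 / (2 + ρ) := by positivity
  have hV2 : ContDiff ℝ 2 V := hprof.contDiff_velocity
  set δ₀ : ℝ := (1 - q₀) * (1 + ρ / 2) with hδ₀def
  have hδ₀ : 0 < δ₀ := mul_pos (by linarith) (by linarith)
  set Ew : ℝ := (∫⁻ y, ‖fderiv ℝ V y‖ₑ ^ 2 * ENNReal.ofReal (‖y‖ ^ (ρ - 1))).toReal with hEw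
  have hA0 : 0 ≤ A := by
    have h := hA 1 le_rfl
    rw [Real.one_rpow, mul_one] at h
    exact (integral_nonneg fun y => sq_nonneg _).trans h
  set K : ℝ := (B₀ * Real.sqrt (Real.pi * 4 / 3 * max 1 (16 * Ew)) * Real.sqrt Ew +
      B₁ * Real.sqrt (Real.pi * 4 / 3 * max 1 (16 * Ew)) * Real.sqrt A) * (r + 1) ^ (2 : ℝ) / (1 / (2 + ρ)) with hKdef
  have hK0 : 0 ≤ K := by positivity
  refine ⟨K / δ₀, fun q hq hqq₀ => ?_⟩
  have ha : 3 - q * (2 + ρ) = 3 - q / (1 / (2 + ρ)) := by field_simp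
  -- the normalised moment and its two-sided derivative bound
  have hG' : ∀ R : ℝ, 0 < R → HasDerivAt (fun R : ℝ => (∫ y, g (R⁻¹ • y) * ‖curl V y‖ ^ q) * R ^ (-(3 - q * (2 + ρ))))
      (R ^ (-(3 - q * (2 + ρ)) - 1) *
        ((q * (∫ y, g (R⁻¹ • y) * (‖curl V y‖ ^ (q - 2) * ⟪fderiv ℝ V y (curl V y), curl V y⟫)) +
            R⁻¹ * ∫ y, ‖curl V y‖ ^ q * fderiv ℝ g (R⁻¹ • y) (V y)) / (1 / (2 + ρ)))) R :=
    fun R hR => hasDerivAt_normalisedMoment hprof hγ0.ne' hg hgc hq ha hR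
  have hbd : ∀ R : ℝ, 1 ≤ R → |R ^ (-(3 - q * (2 + ρ)) - 1) *
        ((q * (∫ y, g (R⁻¹ • y) * (‖curl V y‖ ^ (q - 2) * ⟪fderiv ℝ V y (curl V y), curl V y⟫)) +
            R⁻¹ * ∫ y, ‖curl V y‖ ^ q * fderiv ℝ g (R⁻¹ • y) (V y)) / (1 / (2 + ρ)))| ≤ K * R ^ (-1 - δ₀) :=
    fun R hR => deriv_normalisedMoment_bound (V := V) (g := g) hρ hρ1 hV2 hE hA hgB hDgB hr hg0 hDg0 hq₀1 hq hqq₀ hR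
  obtain ⟨L, hL⟩ := exists_limit_of_deriv_bound hδ₀ hK0 hG' hbd
  refine ⟨L, fun R hR => ?_⟩
  have hR0 : 0 < R := by linarith
  have e : R ^ (q * (2 + ρ) - 3) * (∫ y, g (R⁻¹ • y) * ‖curl V y‖ ^ q) =
      (∫ y, g (R⁻¹ • y) * ‖curl V y‖ ^ q) * R ^ (-(3 - q * (2 + ρ))) := by
    rw [mul_comm, show -(3 - q * (2 + ρ)) = q * (2 + ρ) - 3 by ring]
  rw [e, show -((1 - q₀) * (1 + ρ / 2)) = -δ₀ by rw [hδ₀def]]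
  exact hL R hR

end Profile

end TwoSidedMoment

end Summit.NavierStokesRegularity.NavierStokesRegularity.Theorems.PowerGaugeEulerLiouville

end
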